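import Mathlib
import HarnessLib
import Summits.HubbardSuperconductivity.HubbardSuperconductivity.Theorems.KLProgrammeKLRegimeTwoVolumeLipGluedWt
import Summits.HubbardSuperconductivity.HubbardSuperconductivity.Theorems.KLProgrammeKLRegimeTwoVolumeGluedProfiles

/-!
# Route `KLProgramme` — crux K3 ENGINE (stmt-HubbardSuperconductivity-20437), stub (e) proof-input «(e)-D-ROWS», G-3 (two profiles): THE WEIGHTED PROFILES `NV`, `ND`
# OF THE DEEP DOOR FROM E1's ONE-VOLUME WEIGHTED MEASURED ARRAYS AT BOTH VOLUMES
# (seat hubbard-kl-k3c4-p1 g24; `--supports` 20437; DROWS-SCOPE-g24 v9 §10.1/§11.2 (C))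

The deep block-step door of the two-volume Lipschitz tower (`…LipBlockStepDeep.lipBlockStep_deep_le`, consumed by `…LipBornDiffStep{,Profile,Kit,KitUnits,Hstep}`)
names two `klGluedWt`-WEIGHTED profiles of block `k`: `NV` — the glued coarse input `klGlue (klLipInput L …)` — and `ND` — the global input difference
`klLipInputDiff L b …`.  Both are ONE-VOLUME data (the located fact of DROWS-SCOPE-g24 §10.1): in the glued weight the profile of the glued coarse input IS the
coarse volume's `klScaleWt L (dk−1)`-weighted profile (`…LipGluedWt.sum_pinned_wt_norm_kernel_klGlue_eq`), which E1's tower measures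
(`…LipTowerDefs.sum_wt_norm_kernel_klLipInput_le`: `≤ ε·klTowerMeasWt L … d k m`); the fine input's glued-weight profile is at most its own-weight profile
(`klGluedWt_le_klLabelWt_fine`), `≤ ε·klTowerMeasWt (bL) … d k m`; the difference by the triangle inequality (`…GluedProfiles.sum_pinned_wt_norm_kernel_sub_le`).

* `glue_wt_profile_le_towerMeasWt` — `hNV` with `NV m := ε·klTowerMeasWt L M β U μ K d k m`;
* `fine_gluedWt_profile_le_towerMeasWt` — the fine input in the glued weight `≤ ε·klTowerMeasWt (bL) … d k m`;
* **`inputDiff_wt_profile_le_towerMeasWt`** — `hND` with `ND m := ε·(klTowerMeasWt (bL) … d k m + klTowerMeasWt L … d k m)`.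

Compositions of landed theorems; nothing asserts the (D) rows, stub (e), VL, K3 or superconductivity.
References: BGM 2006 §2.8 (2.76)–(2.83), §3 [cite: BenfattoGiulianiMastropietro2006].
-/

noncomputable section

namespace Summit.HubbardSuperconductivity.HubbardSuperconductivity.Theorems.TwoVolumeLip

set_option linter.dupNamespace false -- summit = problem name (single-conjunct summit), D-0017

open Finset Literature.MathematicalPhysics.QuantumLattice GrassmannAlgebra Literature.Probability.LatticeModels
  Literature.Probability.LatticeModels.BattleFederbush
open Literature.MathematicalPhysics.QuantumLattice.FermiRG
open Summit.HubbardSuperconductivity.HubbardSuperconductivity.Theorems.KLRegimeSplit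
open Summit.HubbardSuperconductivity.HubbardSuperconductivity.Theorems.KLProgrammeLegKernels
open Summit.HubbardSuperconductivity.HubbardSuperconductivity.Theorems.DispersionFlow
open Summit.HubbardSuperconductivity.HubbardSuperconductivity.Theorems.EngineV8
open Summit.HubbardSuperconductivity.HubbardSuperconductivity.Theorems.TwoVolumeSource
open Summit.HubbardSuperconductivity.HubbardSuperconductivity.Theorems.TwoVolumeDefect

variable {L b M : ℕ} [NeZero L] [NeZero (b * L)]

/-- **`hNV` from the coarse tower**: in the glued weight at rate `dk−1` the pinned weighted profile of the glued coarse input of block `k` is at most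
`ε · klTowerMeasWt L … d k m` (`0 ≤ β`). -/
theorem glue_wt_profile_le_towerMeasWt {β : ℝ} (hβ : 0 ≤ β) (U μ : ℝ) (K : TrigPolyC4v) (d k : ℕ) {m : ℕ} (j : Fin m)
    (x : SpaceTimeIdx (b * L) M × SectorLeg (sectorCount (d * k - 1))) :
    ∑ Y ∈ univ.filter (fun Y : Fin m → SpaceTimeIdx (b * L) M × SectorLeg (sectorCount (d * k - 1)) => Y j = x),
        ‖kernel ℂ (klGlue L b M (sectorCount (d * k - 1)) (klLipInput L M β U μ K d k)) m Y‖ *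
          klGluedWt L b M β (d * k - 1) (sectorCount (d * k - 1)) (univ.image Y) ≤
      imagTimeWeight β M * klTowerMeasWt L M β U μ K d k m := by
  rw [sum_pinned_wt_norm_kernel_klGlue_eq]
  refine le_of_eq_of_le (sum_congr rfl fun Y _ => mul_comm _ _) ?_
  exact sum_wt_norm_kernel_klLipInput_le hβ U μ K d k j _

/-- **The fine input in the glued weight**: `≤ ε · klTowerMeasWt (bL) … d k m` (the glued weight is at most the fine weight). -/
theorem fine_gluedWt_profile_le_towerMeasWt {β : ℝ} (hβ : 0 ≤ β) (U μ : ℝ) (K : TrigPolyC4v) (d k : ℕ) {m : ℕ} (j : Fin m)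
    (x : SpaceTimeIdx (b * L) M × SectorLeg (sectorCount (d * k - 1))) :
    ∑ Y ∈ univ.filter (fun Y : Fin m → SpaceTimeIdx (b * L) M × SectorLeg (sectorCount (d * k - 1)) => Y j = x),
        ‖kernel ℂ (klLipInput (b * L) M β U μ K d k) m Y‖ * klGluedWt L b M β (d * k - 1) (sectorCount (d * k - 1)) (univ.image Y) ≤
      imagTimeWeight β M * klTowerMeasWt (b * L) M β U μ K d k m := by
  refine le_trans (sum_le_sum fun Y _ => mul_le_mul_of_nonneg_left (klGluedWt_le_klLabelWt_fine β (d * k - 1) (univ.image Y)) (norm_nonneg _)) ?_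
  refine le_of_eq_of_le (sum_congr rfl fun Y _ => mul_comm _ _) ?_
  exact sum_wt_norm_kernel_klLipInput_le hβ U μ K d k j x

/-- **`hND` from the two towers**: in the glued weight at rate `dk−1` the pinned weighted profile of the input difference of block `k` is at most
`ε · (klTowerMeasWt (bL) … d k m + klTowerMeasWt L … d k m)` (`0 ≤ β`). -/
theorem inputDiff_wt_profile_le_towerMeasWt [NeZero M] {β : ℝ} (hβ : 0 ≤ β) (U μ : ℝ) (K : TrigPolyC4v) (d k : ℕ) {m : ℕ} (j : Fin m)
    (x : SpaceTimeIdx (b * L) M × SectorLeg (sectorCount (d * k - 1))) :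
    ∑ Y ∈ univ.filter (fun Y : Fin m → SpaceTimeIdx (b * L) M × SectorLeg (sectorCount (d * k - 1)) => Y j = x),
        ‖kernel ℂ (klLipInputDiff L b M β U μ K d k) m Y‖ * klGluedWt L b M β (d * k - 1) (sectorCount (d * k - 1)) (univ.image Y) ≤
      imagTimeWeight β M * (klTowerMeasWt (b * L) M β U μ K d k m + klTowerMeasWt L M β U μ K d k m) := by
  rw [klLipInputDiff_def, mul_add]
  exact sum_pinned_wt_norm_kernel_sub_le _ _ j x _ (fun S => (isTreeWeight_klGluedWt (L := L) (b := b) (M := M) hβ (d * k - 1) (sectorCount (d * k - 1))).nonneg S)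
    (fine_gluedWt_profile_le_towerMeasWt hβ U μ K d k j x) (glue_wt_profile_le_towerMeasWt hβ U μ K d k j x)

end Summit.HubbardSuperconductivity.HubbardSuperconductivity.Theorems.TwoVolumeLip

end
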